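import Summits.BirchSwinnertonDyer.BirchSwinnertonDyer.Theorems.GenusKolyvaginAtTwoGenusPrimitiveSupplyAtTwoTwoTranspositionIff
import HarnessLib

/-!
# Route `GenusKolyvaginAtTwo`, crux #2 `GenusPrimitiveSupplyAtTwo` (stmt-BirchSwinnertonDyer-22136):
# T-2q `F1Sign2.TwoDoor.TwoTranspositionTwistLawAtTwo` BY NAME FROM THE ONE-PLACE DICTIONARY — the exact residual of T-2q made a Lean hypothesis

Width seat `bsd-line-gk2-p4` g14 (cell `bsd-f1-sign2`), sequel of `…TwoTranspositionCount` (counting half, gk2-p4 g13) and `…TwoTranspositionIff`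
(quadratic `iff` in frame currency, this seat). THEOREMS ONLY; helper `--supports stmt-BirchSwinnertonDyer-22136`; no item is closed; BSD is not proved.

WHAT. `twoTranspositionTwistLawAtTwo_of_dictionary`: T-2q VERBATIM follows from the ONE-PLACE DICTIONARY at the two door primes — «for a class `c` of the
∞-relaxed `2`-Selmer group of `W` and a door prime `q_i ∣ d` with place `v_i`: `c ∈ twistCondAbove W χ q_i ↔ loc_{v_i} c = 0`» (the twisted `PrimeTwist`
condition of Mazur–Rubin 2007's `A_χ` above a ramified transposition prime meets `W`'s own Kummer line, which contains `loc_{v_i} c`, only in `0`).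
The dictionary is displayed as the hypothesis `hdict`; everything else (counting half, quadratic `iff`, Poitou–Tate inputs) is a tree theorem.
Honest framing: CONDITIONAL reduction; the dictionary (Mazur–Rubin 2007 §3 / Prop. 4.1 at `p = 2` for the quadratic-twist model, REF1 §41's
`TwistModelDictionaryAtTwo` in local form) is NOT proved here.

References: [MazurRubin2010] §3; [MazurRubin2007, §3, Prop 4.1, Def 4.3]; [PoonenRains2012] Thm. 4.14.
-/

set_option linter.dupNamespace false -- tree convention: `Summit.BirchSwinnertonDyer.BirchSwinnertonDyer.Theorems` (summit = sub-problem)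
set_option autoImplicit false

noncomputable section

open scoped Classical ContRepresentation

namespace Summit.BirchSwinnertonDyer.BirchSwinnertonDyer.Theorems.GenusKolyTransp

open WeierstrassCurve Field NumberField IsDedekindDomain Function
open Literature.NumberTheory.EllipticCurves Literature.NumberTheory.GaloisRepresentations
open Literature.NumberTheory.GaloisCohomology
open Rat.HeightOneSpectrum (primesEquiv natGenerator)
open Summit.BirchSwinnertonDyer.Rank1Residual.F1Sign2
open Summit.BirchSwinnertonDyer.Rank1Residual.F1Sign2.TranspositionDoor (MeetsNonNormAt)
open Summit.BirchSwinnertonDyer.Rank1Residual.F1Sign2.TwoDoor (TwoTranspAdmissible twistCondAbove TwoTranspositionTwistLawAtTwo)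
open Summit.BirchSwinnertonDyer.BirchSwinnertonDyer.Theorems.GenusKolyTwistingPrime (primesEquiv_eq)

/-! ## §28 T-2q from the one-place dictionary -/

/-- **T-2q `TwoTranspositionTwistLawAtTwo` FROM THE ONE-PLACE DICTIONARY.** If, for every curve and two-transposition-admissible `(d, q₀, q₁)` with
character `χ` of `ℚ(√d)`, every class `c` of the ∞-relaxed `2`-Selmer group of `W` satisfies «`c ∈ twistCondAbove W χ q_i ↔ loc_{v_i} c = 0`» at the
places `v_i` of the two door primes (`hdict`), then T-2q holds verbatim: the counting clauses are `twoTranspositionTwistLaw_card`, the quadratic `iff`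
is `twoTranspositionTwistLaw_iff_strict_relaxedAtInfinity`. [cite: MazurRubin2010, Lemma 3.2 and Prop 3.3] [cite: PoonenRains2012, Thm. 4.14] -/
theorem twoTranspositionTwistLawAtTwo_of_dictionary
    (hdict : ∀ (W : WeierstrassCurve ℚ) [W.IsElliptic] [W.IsGloballyMinimal] (d : ℤ) (q₀ q₁ : ℕ) [Fact q₀.Prime] [Fact q₁.Prime]
      (χ : Field.absoluteGaloisGroup ℚ →ₜ* Multiplicative (ZMod 2)),
      TwoTranspAdmissible W d q₀ q₁ → IsQuadraticCharacterOf χ d →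
      ∀ (q : ℕ) (v : HeightOneSpectrum (𝓞 ℚ)), (q = q₀ ∨ q = q₁) → (q : 𝓞 ℚ) ∈ v.asIdeal →
        ∀ c ∈ selmerGroupRelaxedAtInfinityAtTwo W,
          c ∈ twistCondAbove W χ q ↔ galoisCohomology.localization (W.torsionGaloisModule ((2 : ℕ) : ℤ)) (Sum.inr v) 1 c = 0) :
    TwoTranspositionTwistLawAtTwo := by
  intro W _ _ _ hΔ hT hrank hSha hegg d q₀ q₁ _ _ χ hadm hχ
  have hcard := twoTranspositionTwistLaw_card W hΔ hT hrank hSha hegg d q₀ q₁ hadm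
  refine ⟨fun hdoor ↦ ⟨hcard.1 hdoor, ?_⟩, hcard.2⟩
  have hq₀ : q₀.Prime := Fact.out
  have hq₁ : q₁.Prime := Fact.out
  -- the places of the two door primes
  have hplace : ∀ {q : ℕ} (hq : q.Prime), ∃ v : HeightOneSpectrum (𝓞 ℚ), (q : 𝓞 ℚ) ∈ v.asIdeal := fun {q} hq ↦
    ⟨primesEquiv.symm ⟨q, hq⟩, by
      have h := Rat.HeightOneSpectrum.natCast_natGenerator_mem (primesEquiv.symm ⟨q, hq⟩)
      rwa [show natGenerator (primesEquiv.symm ⟨q, hq⟩) = q from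
        congrArg Subtype.val (primesEquiv.apply_symm_apply (⟨q, hq⟩ : Nat.Primes))] at h⟩
  obtain ⟨v₀, hv₀⟩ := hplace hq₀
  obtain ⟨v₁, hv₁⟩ := hplace hq₁
  have hd₀ := hdict W d q₀ q₁ χ hadm hχ q₀ v₀ (Or.inl rfl) hv₀
  have hd₁ := hdict W d q₀ q₁ χ hadm hχ q₁ v₁ (Or.inr rfl) hv₁
  -- the two intersections agree
  have key : selmerGroupRelaxedAtInfinityAtTwo W ⊓ twistCondAbove W χ q₀ ⊓ twistCondAbove W χ q₁ =
      selmerGroupRelaxedAtInfinityAtTwo W ⊓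
          (galoisCohomology.localization (W.torsionGaloisModule ((2 : ℕ) : ℤ)) (Sum.inr v₀) 1).ker ⊓
          (galoisCohomology.localization (W.torsionGaloisModule ((2 : ℕ) : ℤ)) (Sum.inr v₁) 1).ker := by
    ext c
    simp only [AddSubgroup.mem_inf]
    constructor
    · rintro ⟨⟨hR, h0⟩, h1⟩
      exact ⟨⟨hR, (hd₀ c hR).mp h0⟩, (hd₁ c hR).mp h1⟩
    · rintro ⟨⟨hR, h0⟩, h1⟩
      exact ⟨⟨hR, (hd₀ c hR).mpr h0⟩, (hd₁ c hR).mpr h1⟩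
  rw [key]
  exact twoTranspositionTwistLaw_iff_strict_relaxedAtInfinity W hΔ hT hrank hSha hegg d q₀ q₁ hadm v₀ v₁ hv₀ hv₁ hdoor

end Summit.BirchSwinnertonDyer.BirchSwinnertonDyer.Theorems.GenusKolyTransp

end
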